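import Literature.NumberTheory.Automorphic.ArchStableClassTorusFibreProduct    -- ★ FILE E p840833 (F0P3a-p05 (g11)): `sum_univ_mk_archDiagTorus_comp_eq_sum_piFinset_of_const`; brings ★ FILE C, ★ p02 `ArchLocalStableOrbitalSumTorus`
import Literature.NumberTheory.Automorphic.ArchLocalSplitSingularTorusFibres   -- ★ FILE D p840796: `mk_circleDiagonal_comp_eq_mk_swap_pos_iff`, the counts `2p` ∕ `2·#{e<0}`
import HarnessLib

/-!
# The all-relabellings sum at a torus point of `G′_∞` SINGULAR AT ONE PLACE `w₀` (split-singular there, regular elsewhere) as a transversal (class) sum with EXPLICIT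
# multiplicities `p_w!(3−p_w)!` off `w₀` and `2p₀ : 2(3−p₀)` at `w₀` — after ★ (j2)'s factor `K⁻¹`: coefficient `2` on the `γ₀`-class, `1` on the `γ₀′`-class (Rogawski 1990 §8.2 Prop. 8.2.1 p. 118, p. 123)

Topic `NumberTheory/Automorphic`; namespace `Literature.NumberTheory.Automorphic.UnitaryGroup`.  THEOREMS ONLY (no definition, no instance, no notation, no named fact, no `sorry`).
Cell `pub/hodgecm-mathlib`, ENGINE T1 (crux H413 = `stmt-HodgeConjecture-24833`); floor-1 preparation, count-neutral, under books rows #88 (ST-∞) ∕ #111 (S-d): road D2′∕ROAD-Sd, brick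
**(o17) «(δ)→CLASS-SUM CAPSTONE»** (LEAD WORD T8-52, F0P3a-plan (g9): three-hand split — F0P3a-p07 (g7) (δ) regular half, F0P3a-p03 (g10) (δ′) singular half, this file the conversion both import;
author F0P3a-p05 (g11)).  BY NAME over ★ FILE E `ArchStableClassTorusFibreProduct` (p840833), ★ FILE D `ArchLocalSplitSingularTorusFibres` (p840796), ★ F0P3a-p02 `ArchLocalStableOrbitalSumTorus`
(`card_filter_mk_circleDiagonal_eq_factorial`: at a REGULAR torus point every fibre of `σ ↦ ⟦diag(z∘σ)⟧` has `p_w!(N−p_w)!` elements).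

SETTING (the (δ) shape).  `z : W → Fin 3 → Circle` with `z w` INJECTIVE for `w ≠ w₀` and `z w₀` two-valued (singular slot `k`, constant off `k`); `w₀` INDEFINITE (slots `ip`, `im` with
`0 < re σ_{w₀}(α ip)`, `re σ_{w₀}(α im) < 0`); `α_i ≠ 0`, `c(α_i) = α_i`; `p w := #{i ∣ 0 < re σ_w(α i)}`; per-place transversals `R w` (`hcov`, `hinj` as in ★ FILE C — e.g. `R w₀ = {swap k ip, swap k im}` ★,
any transversal of the `C(3, p_w)` regular classes off `w₀`).

WHAT IS PROVED.
* §1 (per place, generic `U` + dock) **`card_filter_mk_circleDiagonal_comp_eq_ite`**: for EVERY `σ ∈ S₃`, `#{ρ ∣ ⟦diag(z∘ρ)⟧ = ⟦diag(z∘σ)⟧} = if 0 < e (σ⁻¹ k) then 2·#{0 < e} else 2·#{e < 0}` (★ FILE D);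
  **`factorial_card_pos_mul_factorial_eq_two`**: at an indefinite place `p! · (3 − p)! = 2`.
* §2 (global) **`sum_univ_mk_archDiagTorus_comp_eq_sum_piFinset_of_singularAt`**: `Σ_{ρ : W → S₃} F(⟦t(z∘ρ)⟧) = Σ_{r ∈ Π_w R w} ((∏_{w ≠ w₀} p_w!(3−p_w)!) · m_{w₀}(r_{w₀})) • F(⟦t(z∘r)⟧)` with
  `m_{w₀}(σ) = if 0 < e₀(σ⁻¹ k) then 2p₀ else 2·#{e₀ < 0}` (★ FILE E `_of_const` + ★ p02 + §1); and the NORMALISED form **`sum_univ_mk_archDiagTorus_comp_eq_prod_mul_sum_piFinset_two_one`**: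
  `Σ_ρ F(⟦t(z∘ρ)⟧) = (∏_w p_w!(3−p_w)!) • Σ_{r ∈ Π_w R w} (if «`b` sits over a slot of the MAJORITY sign at `w₀`» then 2 else 1) • F(⟦t(z∘r)⟧)` — i.e. after ★ (j2)'s `K⁻¹`, coefficient `2` on the class
  whose `a`-plane is INDEFINITE (`e = +1`, print's `γ, γ₁ → γ₀`) and `1` on the class whose `a`-plane is DEFINITE (`e = −1`, `γ₂ → γ₀′`), at `(2,1)` AND `(1,2)` places alike.
HONEST LABEL: HC_CM is proved only modulo the printed citations until rung 0 closes; this file is finite bookkeeping and pays nothing by itself.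

## References
* [Rogawski1990] J. D. Rogawski, *Automorphic Representations of Unitary Groups in Three Variables*, Ann. of Math. Stud. 123 (1990): §4.1 (4.1.1) p. 39, §8.2 Prop. 8.2.1 p. 118 (`γ, γ₁, γ₂`),
  p. 123 («`−2cF′(γ₀′)`»), §8.3 p. 122.
* [BorelJacquet1979] A. Borel, H. Jacquet, *Automorphic forms and automorphic representations*, PSPM 33.1 (1979), §4.1.
-/

set_option autoImplicit false

noncomputable section

open MeasureTheory Matrix Equiv Finset NumberField NumberField.InfinitePlace
open Literature.LinearAlgebra.Matrix Literature.NumberTheory.Rogawski1990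
open scoped MatrixGroups ComplexConjugate

namespace Literature.NumberTheory.Automorphic.UnitaryGroup

/-! ## §1 Per place: the fibre size through ANY relabelling at the split-singular point; `p!(3−p)! = 2` at an indefinite place -/

section Place

variable (U : Subgroup (GL (Fin 3) ℂ)) {e : Fin 3 → ℝ}

open scoped Classical in
/-- **`#fibre(⟦diag(z ∘ σ)⟧) = if 0 < e(σ⁻¹ k) then 2·#{0 < e} else 2·#{e < 0}`** for EVERY `σ ∈ S₃` (the class of `z ∘ σ` is `C₊` or `C₋` according to the sign of the slot carrying `b`, ★ FILE D).
[cite: Rogawski1990, §8.2 Prop. 8.2.1 p. 118; §8.3 p. 122] -/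
theorem card_filter_mk_circleDiagonal_comp_eq_ite (hU : ∀ g : GL (Fin 3) ℂ, g ∈ U ↔ g ∈ unitaryGroupOfForm (starRingEnd ℂ) (diagonal fun i => (e i : ℂ)))
    (he : ∀ i, e i ≠ 0) {z : Fin 3 → Circle} {k : Fin 3} (hk : ∀ j, z j = z k ↔ j = k) (hzz : ∀ i j, i ≠ k → j ≠ k → z i = z j)
    {ip im : Fin 3} (hip : 0 < e ip) (him : e im < 0) (σ : Perm (Fin 3)) :
    (univ.filter fun ρ : Perm (Fin 3) =>
        ConjClasses.mk (⟨circleDiagonal 3 (z ∘ ρ), circleDiagonal_mem_of_iff 3 U hU (z ∘ ρ)⟩ : U) =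
          ConjClasses.mk (⟨circleDiagonal 3 (z ∘ σ), circleDiagonal_mem_of_iff 3 U hU (z ∘ σ)⟩ : U)).card =
      if 0 < e (σ.symm k) then 2 * (univ.filter fun i => 0 < e i).card else 2 * (univ.filter fun i => e i < 0).card := by
  split_ifs with hσ
  · rw [(mk_circleDiagonal_comp_eq_mk_swap_pos_iff U hU he hk hzz hip him σ).mpr hσ]
    exact card_filter_mk_circleDiagonal_comp_eq_swap_pos U hU he hk hzz hip him
  · have hneg : e (σ.symm k) < 0 := lt_of_le_of_ne (not_lt.mp hσ) (he _)
    rw [(mk_circleDiagonal_comp_eq_mk_swap_neg_iff U hU he hk hzz hip him σ).mpr hneg]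
    exact card_filter_mk_circleDiagonal_comp_eq_swap_neg U hU he hk hzz hip him

open scoped Classical in
/-- **At an indefinite place `p!(3 − p)! = 2`** (`p = #{i ∣ 0 < e i} ∈ {1, 2}` when `e` takes both signs on `Fin 3`). [cite: Rogawski1990, §8.2 Prop. 8.2.1 p. 118] -/
theorem factorial_card_pos_mul_factorial_eq_two {ip im : Fin 3} (hip : 0 < e ip) (him : e im < 0) :
    (univ.filter fun i => 0 < e i).card.factorial * (3 - (univ.filter fun i => 0 < e i).card).factorial = 2 := by
  have h1 : 1 ≤ (univ.filter fun i => 0 < e i).card :=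
    Finset.card_pos.mpr ⟨ip, Finset.mem_filter.mpr ⟨Finset.mem_univ _, hip⟩⟩
  have h2 : (univ.filter fun i => 0 < e i).card ≤ 2 := by
    have hsub : (univ.filter fun i => 0 < e i) ⊆ univ.erase im := fun i hi => by
      rw [Finset.mem_erase]
      refine ⟨fun h => ?_, Finset.mem_univ _⟩
      rw [Finset.mem_filter] at hi
      rw [h] at hi
      exact lt_irrefl _ (him.trans hi.2)
    have := Finset.card_le_card hsub
    rw [Finset.card_erase_of_mem (Finset.mem_univ _), Finset.card_univ, Fintype.card_fin] at this
    exact this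
  interval_cases (univ.filter fun i => 0 < e i).card <;> decide

open scoped Classical in
/-- The two counts at an indefinite place: `#{0 < e} + #{e < 0} = 3` (no zero weight). [folklore] -/
private theorem card_pos_add_card_neg_eq_three (he : ∀ i, e i ≠ 0) :
    (univ.filter fun i => 0 < e i).card + (univ.filter fun i => e i < 0).card = 3 := by
  have h := Finset.card_filter_add_card_filter_not (s := (univ : Finset (Fin 3))) (fun i => 0 < e i)
  have hneg : (univ.filter fun i => ¬ 0 < e i) = univ.filter fun i => e i < 0 := by
    ext i
    simp only [Finset.mem_filter, Finset.mem_univ, true_and, not_lt]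
    exact ⟨fun h => lt_of_le_of_ne h (he i), le_of_lt⟩
  rw [hneg, Finset.card_univ, Fintype.card_fin] at h
  exact h

open scoped Classical in
/-- **THE NORMALISED MULTIPLICITY IS `2` OR `1`**: at an indefinite place, `m(σ) = (p!(3−p)!) · (if «the slot `σ⁻¹ k` carrying `b` has the MAJORITY sign» then 2 else 1)` — the class with `b` over a
majority-sign slot has the INDEFINITE `a`-plane (one weight of each sign): `e = +1`, print's `γ₀`, coefficient `2`; the other class (`a`-plane definite, `e = −1`, `γ₀′`) coefficient `1`.
[cite: Rogawski1990, §8.2 Prop. 8.2.1 p. 118, p. 123] -/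
theorem ite_card_eq_two_mul_ite (he : ∀ i, e i ≠ 0) {ip im : Fin 3} (hip : 0 < e ip) (him : e im < 0) (s : Fin 3) :
    (if 0 < e s then 2 * (univ.filter fun i => 0 < e i).card else 2 * (univ.filter fun i => e i < 0).card) =
      ((univ.filter fun i => 0 < e i).card.factorial * (3 - (univ.filter fun i => 0 < e i).card).factorial) *
        (if (0 < e s ↔ 2 ≤ (univ.filter fun i => 0 < e i).card) then 2 else 1) := by
  rw [factorial_card_pos_mul_factorial_eq_two hip him]
  have h3 := card_pos_add_card_neg_eq_three he
  have h1 : 1 ≤ (univ.filter fun i => 0 < e i).card := Finset.card_pos.mpr ⟨ip, Finset.mem_filter.mpr ⟨Finset.mem_univ _, hip⟩⟩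
  have h1' : 1 ≤ (univ.filter fun i => e i < 0).card := Finset.card_pos.mpr ⟨im, Finset.mem_filter.mpr ⟨Finset.mem_univ _, him⟩⟩
  by_cases hs : 0 < e s
  · rw [if_pos hs]
    by_cases hp : 2 ≤ (univ.filter fun i => 0 < e i).card
    · rw [if_pos (iff_of_true hs hp)]; omega
    · rw [if_neg (fun h => hp (h.mp hs))]; omega
  · rw [if_neg hs]
    by_cases hp : 2 ≤ (univ.filter fun i => 0 < e i).card
    · rw [if_neg (fun h => hs (h.mpr hp))]; omega
    · rw [if_pos (iff_of_false hs hp)]; omega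

end Place

/-! ## §2 Global: the (δ) shape — singular at `w₀`, regular elsewhere -/

section Global

variable (L : Type) [Field L] [NumberField L] [IsCMField L] (α : Fin 3 → L)

open scoped Classical in
/-- **THE ALL-RELABELLINGS SUM AT A TORUS POINT SINGULAR AT `w₀` ONLY, WITH EXPLICIT MULTIPLICITIES**: `Σ_{ρ : W → S₃} F(⟦t(z∘ρ)⟧) = Σ_{r ∈ Π_w R w} ((∏_{w ≠ w₀} p_w!(3−p_w)!) · m_{w₀}(r_{w₀})) • F(⟦t(z∘r)⟧)`,
`m_{w₀}(σ) = if 0 < e₀(σ⁻¹ k) then 2p₀ else 2·#{e₀ < 0}` (★ FILE E `…_of_const` with ★ p02 `card_filter_mk_circleDiagonal_eq_factorial` off `w₀` and §1 at `w₀`).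
[cite: Rogawski1990, §8.2 Prop. 8.2.1 p. 118; §4.1 (4.1.1) p. 39] [cite: BorelJacquet1979, §4.1] -/
theorem sum_univ_mk_archDiagTorus_comp_eq_sum_piFinset_of_singularAt {M : Type*} [AddCommMonoid M]
    (hα : ∀ i, α i ≠ 0) (hherm : ∀ i, (IsCMField.complexConj L (α i) : L) = α i)
    (z : {w : InfinitePlace L // IsComplex w} → Fin 3 → Circle) (w₀ : {w : InfinitePlace L // IsComplex w})
    (hreg : ∀ w, w ≠ w₀ → Function.Injective (z w))
    {k : Fin 3} (hk : ∀ j, z w₀ j = z w₀ k ↔ j = k) (hzz : ∀ i j, i ≠ k → j ≠ k → z w₀ i = z w₀ j)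
    {ip im : Fin 3} (hip : 0 < (w₀.1.embedding (α ip)).re) (him : (w₀.1.embedding (α im)).re < 0)
    (R : {w : InfinitePlace L // IsComplex w} → Finset (Perm (Fin 3)))
    (hcov : ∀ (w : {w : InfinitePlace L // IsComplex w}) (ρ : Perm (Fin 3)), ∃ r ∈ R w,
      ConjClasses.mk (⟨circleDiagonal 3 (z w ∘ ρ), circleDiagonal_mem_archLocal_diagonal L 3 α w (z w ∘ ρ)⟩ : archLocal L 3 (diagonal α) w) =
        ConjClasses.mk (⟨circleDiagonal 3 (z w ∘ r), circleDiagonal_mem_archLocal_diagonal L 3 α w (z w ∘ r)⟩ : archLocal L 3 (diagonal α) w))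
    (hinj : ∀ w : {w : InfinitePlace L // IsComplex w}, Set.InjOn (fun r : Perm (Fin 3) =>
      ConjClasses.mk (⟨circleDiagonal 3 (z w ∘ r), circleDiagonal_mem_archLocal_diagonal L 3 α w (z w ∘ r)⟩ : archLocal L 3 (diagonal α) w)) ↑(R w))
    (F : ConjClasses ↥(arch (↥(maximalRealSubfield L)) L (IsCMField.complexConj L) 3 (diagonal α)) → M) :
    ∑ ρ : {w : InfinitePlace L // IsComplex w} → Perm (Fin 3), F (ConjClasses.mk (archDiagTorus L 3 α fun w => z w ∘ ρ w)) =
      ∑ r ∈ Fintype.piFinset R,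
        ((∏ w ∈ univ.erase w₀, (univ.filter fun i => 0 < (w.1.embedding (α i)).re).card.factorial *
            (3 - (univ.filter fun i => 0 < (w.1.embedding (α i)).re).card).factorial) *
          (if 0 < (w₀.1.embedding (α ((r w₀).symm k))).re then 2 * (univ.filter fun i => 0 < (w₀.1.embedding (α i)).re).card
            else 2 * (univ.filter fun i => (w₀.1.embedding (α i)).re < 0).card)) •
          F (ConjClasses.mk (archDiagTorus L 3 α fun w => z w ∘ r w)) := by
  have hreal : ∀ (w : {w : InfinitePlace L // IsComplex w}) (i : Fin 3), (w.1.embedding (α i)).im = 0 := fun w i => im_embedding_diagonal_eq_zero L 3 α hherm w i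
  rw [sum_univ_mk_archDiagTorus_comp_eq_sum_piFinset_of_const L 3 α z R hcov hinj w₀
    (fun w => (univ.filter fun i => 0 < (w.1.embedding (α i)).re).card.factorial * (3 - (univ.filter fun i => 0 < (w.1.embedding (α i)).re).card).factorial)
    (fun w hw r _ => card_filter_mk_circleDiagonal_eq_factorial L 3 α w hα (hreal w) (hreg w hw) r) F]
  refine Finset.sum_congr rfl fun r _ => ?_
  rw [card_filter_mk_circleDiagonal_comp_eq_ite (archLocal L 3 (diagonal α) w₀) (mem_archLocal_diagonal_iff_mem_unitaryGroupOfForm L 3 α w₀ (hreal w₀))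
    (re_embedding_ne_zero L 3 α w₀ hα (hreal w₀)) hk hzz hip him (r w₀)]

open scoped Classical in
/-- **NORMALISED FORM — COEFFICIENTS `2 : 1`**: `Σ_{ρ : W → S₃} F(⟦t(z∘ρ)⟧) = (∏_w p_w!(3−p_w)!) • Σ_{r ∈ Π_w R w} (if (0 < e₀((r w₀)⁻¹ k) ↔ 2 ≤ p₀) then 2 else 1) • F(⟦t(z∘r)⟧)` — after ★ (j2)'s factor
`K⁻¹ = (∏_w p_w!(3−p_w)!)⁻¹` the class whose `a`-plane at `w₀` is INDEFINITE (`b` over a majority-sign slot; `e = +1`, print's `γ, γ₁ → γ₀`) carries `2`, the class with DEFINITE `a`-plane (`e = −1`,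
`γ₂ → γ₀′`) carries `1` — at `(2,1)` and `(1,2)` places alike. [cite: Rogawski1990, §8.2 Prop. 8.2.1 p. 118, p. 123] [cite: BorelJacquet1979, §4.1] -/
theorem sum_univ_mk_archDiagTorus_comp_eq_prod_smul_sum_piFinset_two_one {M : Type*} [AddCommMonoid M]
    (hα : ∀ i, α i ≠ 0) (hherm : ∀ i, (IsCMField.complexConj L (α i) : L) = α i)
    (z : {w : InfinitePlace L // IsComplex w} → Fin 3 → Circle) (w₀ : {w : InfinitePlace L // IsComplex w})
    (hreg : ∀ w, w ≠ w₀ → Function.Injective (z w))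
    {k : Fin 3} (hk : ∀ j, z w₀ j = z w₀ k ↔ j = k) (hzz : ∀ i j, i ≠ k → j ≠ k → z w₀ i = z w₀ j)
    {ip im : Fin 3} (hip : 0 < (w₀.1.embedding (α ip)).re) (him : (w₀.1.embedding (α im)).re < 0)
    (R : {w : InfinitePlace L // IsComplex w} → Finset (Perm (Fin 3)))
    (hcov : ∀ (w : {w : InfinitePlace L // IsComplex w}) (ρ : Perm (Fin 3)), ∃ r ∈ R w,
      ConjClasses.mk (⟨circleDiagonal 3 (z w ∘ ρ), circleDiagonal_mem_archLocal_diagonal L 3 α w (z w ∘ ρ)⟩ : archLocal L 3 (diagonal α) w) =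
        ConjClasses.mk (⟨circleDiagonal 3 (z w ∘ r), circleDiagonal_mem_archLocal_diagonal L 3 α w (z w ∘ r)⟩ : archLocal L 3 (diagonal α) w))
    (hinj : ∀ w : {w : InfinitePlace L // IsComplex w}, Set.InjOn (fun r : Perm (Fin 3) =>
      ConjClasses.mk (⟨circleDiagonal 3 (z w ∘ r), circleDiagonal_mem_archLocal_diagonal L 3 α w (z w ∘ r)⟩ : archLocal L 3 (diagonal α) w)) ↑(R w))
    (F : ConjClasses ↥(arch (↥(maximalRealSubfield L)) L (IsCMField.complexConj L) 3 (diagonal α)) → M) :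
    ∑ ρ : {w : InfinitePlace L // IsComplex w} → Perm (Fin 3), F (ConjClasses.mk (archDiagTorus L 3 α fun w => z w ∘ ρ w)) =
      (∏ w : {w : InfinitePlace L // IsComplex w}, (univ.filter fun i => 0 < (w.1.embedding (α i)).re).card.factorial *
          (3 - (univ.filter fun i => 0 < (w.1.embedding (α i)).re).card).factorial) •
        ∑ r ∈ Fintype.piFinset R,
          (if (0 < (w₀.1.embedding (α ((r w₀).symm k))).re ↔ 2 ≤ (univ.filter fun i => 0 < (w₀.1.embedding (α i)).re).card) then 2 else 1) •
            F (ConjClasses.mk (archDiagTorus L 3 α fun w => z w ∘ r w)) := by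
  have hreal : ∀ i : Fin 3, (w₀.1.embedding (α i)).im = 0 := fun i => im_embedding_diagonal_eq_zero L 3 α hherm w₀ i
  rw [sum_univ_mk_archDiagTorus_comp_eq_sum_piFinset_of_singularAt L α hα hherm z w₀ hreg hk hzz hip him R hcov hinj F, Finset.smul_sum]
  refine Finset.sum_congr rfl fun r _ => ?_
  rw [ite_card_eq_two_mul_ite (e := fun i => (w₀.1.embedding (α i)).re) (re_embedding_ne_zero L 3 α w₀ hα hreal) hip him ((r w₀).symm k),
    ← mul_assoc, Finset.prod_erase_mul _ _ (Finset.mem_univ w₀), mul_smul]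

end Global

end Literature.NumberTheory.Automorphic.UnitaryGroup

end
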